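import Summits.KontsevichZagierPeriods.KontsevichZagierPeriods.Theorems.LiouvilleUnfoldingLogPrimitiveNLStructureEnginePoint
import Literature.NumberTheory.Transcendental.KZLogCalculusProofs
import Literature.NumberTheory.Transcendental.KZSemialgebraicComplex
import HarnessLib

/-!
# `LogPrimitiveNL` (stmt-KontsevichZagierPeriods-2836), line `ax-schanuel-germs`, stub `stub_structure` —
part E: the engine on a uniform cell

On an open `ℚ`-semialgebraic cell with smooth data and the uniformity dichotomy (for every integer
`f`, `W^f` constant or the zero set of its log-gradient has empty interior), the coefficient vector
`h(x)` lies at EVERY point in the real span of the cell lattice `{f | W^f constant}`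
(`engine_cell`): good points are co-null (countably many null semialgebraic zero sets), a generic
direction avoids countably many hyperplanes (`exists_direction`, Lebesgue measure of proper
subspaces), `engine_point` on the restriction to the line, double orthogonality, density and
continuity. [folklore assembly of the line's stubs]
-/

noncomputable section

open Set Filter MvPolynomial MeasureTheory
open scoped ContDiff Topology LaurentSeries RatFunc Polynomial
open Literature.NumberTheory.Transcendental Literature.ModelTheory.ExponentialFields

namespace Summit.KontsevichZagierPeriods.LiouvilleUnfolding.LogPrimitiveNL.AxSchanuelGerms

-- canonical `ℤ`-algebra structure on `ℝ⸨X⸩` (see part C)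
attribute [local instance 10000] Ring.toIntAlgebra

/-! ### Part E: the engine on a uniform cell -/

section Cell

/-- The zero set, inside `s`, of a semialgebraic function is semialgebraic. [folklore] -/
theorem isSemialgebraic_sep_eq_zero {k : Type*} [CommRing k] [Algebra k ℝ] {m : ℕ}
    {s : Set (Fin m → ℝ)} {f : (Fin m → ℝ) → ℝ} (hf : IsSemialgebraicFunOn k s f) :
    IsSemialgebraic k {x | x ∈ s ∧ f x = 0} := by
  have h1 := IsSemialgebraicFunOn.isSemialgebraic_sep_nonneg hf
  have h2 := IsSemialgebraicFunOn.isSemialgebraic_sep_nonneg (IsSemialgebraicFunOn.neg hf)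
  convert h1.inter h2 using 1
  ext x
  simp only [mem_setOf_eq, mem_inter_iff, Pi.neg_apply, neg_nonneg]
  constructor
  · rintro ⟨hx, h0⟩
    exact ⟨⟨hx, h0.ge⟩, hx, h0.le⟩
  · rintro ⟨⟨hx, h0⟩, -, h0'⟩
    exact ⟨hx, le_antisymm h0' h0⟩

/-- A `ℚ`-semialgebraic subset of `ℝⁿ` with empty interior is Lebesgue-null (it lies in its
frontier, which is null). [folklore] -/
theorem volume_eq_zero_of_interior_eq_empty {n : ℕ} {Z : Set (Fin n → ℝ)} (hZ : IsSemialgebraic ℚ Z)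
    (hint : interior Z = ∅) : volume Z = 0 := by
  refine measure_mono_null (fun x hx => ?_) (volume_frontier_eq_zero_of_isSemialgebraic hZ)
  rw [frontier, hint, sdiff_empty]
  exact subset_closure hx

/-- Off a null set, every point of an open set lies in the closure of the remaining points.
[folklore] -/
theorem mem_closure_diff_of_null {n : ℕ} {C B : Set (Fin n → ℝ)} (hCo : IsOpen C)
    (hB : volume B = 0) {x : Fin n → ℝ} (hx : x ∈ C) : x ∈ closure (C \ B) := by
  rw [mem_closure_iff_nhds]
  intro U hU
  by_contra hempty
  rw [Set.not_nonempty_iff_eq_empty] at hempty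
  obtain ⟨V, hVU, hVo, hxV⟩ := mem_nhds_iff.1 (inter_mem hU (hCo.mem_nhds hx))
  have hsub : V ⊆ B := by
    intro y hy
    by_contra hyB
    have : y ∈ U ∩ (C \ B) := ⟨(hVU hy).1, (hVU hy).2, hyB⟩
    rw [hempty] at this
    exact this
  have hpos : 0 < volume V := hVo.measure_pos volume ⟨x, hxV⟩
  have hle : volume V ≤ 0 := (measure_mono hsub).trans_eq hB
  exact absurd (hpos.trans_le hle) (lt_irrefl 0)

/-- **Generic directions**: countably many non-zero vectors of `ℝⁿ` admit a common direction not
orthogonal to any of them (each orthogonal hyperplane is a proper subspace, hence null for Lebesgue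
measure). [folklore] -/
theorem exists_direction {n : ℕ} {ι : Type*} [Countable ι] (u : ι → Fin n → ℝ) (hu : ∀ i, u i ≠ 0) :
    ∃ v : Fin n → ℝ, ∀ i, ∑ j, v j * u i j ≠ 0 := by
  classical
  -- the orthogonal hyperplanes
  let ℓ : ι → (Fin n → ℝ) →ₗ[ℝ] ℝ := fun i =>
    { toFun := fun v => ∑ j, v j * u i j
      map_add' := fun v v' => by simp [add_mul, Finset.sum_add_distrib]
      map_smul' := fun c v => by simp [Finset.mul_sum, mul_assoc] }
  have hℓ : ∀ i, LinearMap.ker (ℓ i) ≠ ⊤ := by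
    intro i htop
    have hmem : u i ∈ LinearMap.ker (ℓ i) := htop ▸ Submodule.mem_top
    rw [LinearMap.mem_ker] at hmem
    have hsq : ∑ j, u i j * u i j = 0 := hmem
    have : ∀ j, u i j = 0 := fun j => by
      have h := (Finset.sum_eq_zero_iff_of_nonneg fun j _ => mul_self_nonneg (u i j)).1 hsq j
        (Finset.mem_univ j)
      exact mul_self_eq_zero.1 h
    exact hu i (funext this)
  have hnull : volume (⋃ i, (LinearMap.ker (ℓ i) : Set (Fin n → ℝ))) = 0 :=
    measure_iUnion_null fun i => Measure.addHaar_submodule volume _ (hℓ i)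
  have huniv : volume (univ : Set (Fin n → ℝ)) ≠ 0 := isOpen_univ.measure_ne_zero volume univ_nonempty
  obtain ⟨v, -, hv⟩ : ∃ v ∈ (univ : Set (Fin n → ℝ)),
      v ∉ ⋃ i, (LinearMap.ker (ℓ i) : Set (Fin n → ℝ)) := by
    by_contra hall
    push Not at hall
    exact huniv (measure_mono_null (fun v hv => hall v hv) hnull)
  refine ⟨v, fun i hi => hv (mem_iUnion.2 ⟨i, ?_⟩)⟩
  simpa [ℓ] using hi

/-- The log-gradient entries `∂ⱼWᵢ/Wᵢ` of positive smooth `ℚ`-semialgebraic functions on an open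
`ℚ`-semialgebraic set are `ℚ`-semialgebraic (Basu–Pollack–Roy Prop. 3.22). [folklore] -/
theorem isSemialgebraicFunOn_logGrad {n k : ℕ} {C : Set (Fin n → ℝ)} (hCs : IsSemialgebraic ℚ C)
    (hCo : IsOpen C) {W : Fin k → (Fin n → ℝ) → ℝ} (hWs : ∀ i, IsSemialgebraicFunOn ℚ C (W i))
    (hWc : ∀ i, ContDiffOn ℝ ∞ (W i) C) (hWpos : ∀ i, ∀ x ∈ C, 0 < W i x) (i : Fin k) (j : Fin n) :
    IsSemialgebraicFunOn ℚ C (fun x => fderiv ℝ (W i) x (Pi.single j 1) / W i x) := by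
  have hd : ∀ x ∈ C, DifferentiableAt ℝ (W i) x := fun x hx =>
    ((hWc i).differentiableOn (by simp)).differentiableAt (hCo.mem_nhds hx)
  have _ := hCs
  exact IsSemialgebraicFunOn.div (IsSemialgebraicFunOn.fderiv_apply_single hCo (hWs i) hd j) (hWs i)
    fun x hx => (hWpos i x hx).ne'

/-- The zero set in the cell of the log-gradient `Ω f = Σᵢ fᵢ ∇Wᵢ/Wᵢ` of a monomial is
`ℚ`-semialgebraic. [folklore] -/
theorem isSemialgebraic_logGradZero {n k : ℕ} {C : Set (Fin n → ℝ)} (hCs : IsSemialgebraic ℚ C)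
    (hCo : IsOpen C) {W : Fin k → (Fin n → ℝ) → ℝ} (hWs : ∀ i, IsSemialgebraicFunOn ℚ C (W i))
    (hWc : ∀ i, ContDiffOn ℝ ∞ (W i) C) (hWpos : ∀ i, ∀ x ∈ C, 0 < W i x) (f : Fin k → ℤ) :
    IsSemialgebraic ℚ {x ∈ C | ∀ j : Fin n,
      ∑ i, (f i : ℝ) * (fderiv ℝ (W i) x (Pi.single j 1) / W i x) = 0} := by
  have hΩ : ∀ j : Fin n, IsSemialgebraicFunOn ℚ C
      (fun x => ∑ i, (f i : ℝ) * (fderiv ℝ (W i) x (Pi.single j 1) / W i x)) := fun j =>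
    IsSemialgebraicFunOn.fun_finsetSum Finset.univ hCs fun i _ =>
      IsSemialgebraicFunOn.fun_mul (isSemialgebraicFunOn_const_intCast hCs (f i))
        (isSemialgebraicFunOn_logGrad hCs hCo hWs hWc hWpos i j)
  have h := IsSemialgebraic.biInter (k := ℚ) (R := ℝ) Finset.univ
    (fun j : Fin n => {x | x ∈ C ∧
      ∑ i, (f i : ℝ) * (fderiv ℝ (W i) x (Pi.single j 1) / W i x) = 0})
    fun j _ => isSemialgebraic_sep_eq_zero (hΩ j)
  convert hCs.inter h using 1
  ext x
  simp only [mem_setOf_eq, Finset.mem_univ, iInter_true, mem_inter_iff, mem_iInter]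
  constructor
  · rintro ⟨hx, h0⟩
    exact ⟨hx, fun j => ⟨hx, h0 j⟩⟩
  · rintro ⟨hx, h0⟩
    exact ⟨hx, fun j => (h0 j).2⟩

end Cell

section CellMain

/-- **The engine on a uniform cell.** On an open `ℚ`-semialgebraic cell `C` with smooth data,
positive `Wᵢ`, the identity `Σ hᵢ log Wᵢ = g`, and the uniformity dichotomy (for every integer
`f`, `W^f` is constant on `C` or the zero set of its log-gradient has empty interior), the
coefficient vector `h(x)` lies, at EVERY point of `C`, in the real span of the lattice
`Λ(C) = {f | W^f constant on C}` — given the four one-variable engine stubs and the double-orthogonal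
lemma as hypotheses. (Good points are co-null; generic direction; `engine_point`; density and
continuity.) [folklore] -/
theorem engine_cell
    (hT : ∃ T : (ℝ → ℝ) → ℝ⸨X⸩,
      (∀ f g : ℝ → ℝ, f =ᶠ[𝓝 0] g → T f = T g) ∧
      (∀ f g : ℝ → ℝ, (∃ U ∈ 𝓝 (0 : ℝ), ContDiffOn ℝ ∞ f U) →
        (∃ U ∈ 𝓝 (0 : ℝ), ContDiffOn ℝ ∞ g U) →
          T (f + g) = T f + T g ∧ T (f * g) = T f * T g) ∧
      (∀ f : ℝ → ℝ, (∃ U ∈ 𝓝 (0 : ℝ), ContDiffOn ℝ ∞ f U) →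
        T (deriv f) = LaurentSeries.derivative ℝ (T f)) ∧
      (∀ c : ℝ, T (fun _ => c) = HahnSeries.C c) ∧
      T (fun t => t) = HahnSeries.single 1 1 ∧
      (∀ f : ℝ → ℝ, ∃ p : PowerSeries ℝ, T f = HahnSeries.ofPowerSeries ℤ ℝ p) ∧
      (∀ f : ℝ → ℝ, (T f).coeff 0 = f 0) ∧
      (∀ f : ℝ → ℝ, (∃ U ∈ 𝓝 (0 : ℝ), ContDiffOn ℝ ∞ f U) →
        (T f = 0 ↔ ∀ n : ℕ, iteratedDeriv n f 0 = 0)))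
    (hpoly : ∀ (φ : ℝ → ℝ) (a b : ℝ), a < b →
      IsSemialgebraicFunOn ℝ {x : Fin 1 → ℝ | x 0 ∈ Ioo a b} (fun x => φ (x 0)) →
        ∃ q : MvPolynomial (Fin 2) ℝ, q ≠ 0 ∧
          ∀ t ∈ Ioo a b, MvPolynomial.eval (Fin.cons (φ t) fun _ => t) q = 0)
    (hflat : ∀ (φ : ℝ → ℝ) (ε : ℝ), 0 < ε →
      IsSemialgebraicFunOn ℝ {x : Fin 1 → ℝ | x 0 ∈ Ioo (-ε) ε} (fun x => φ (x 0)) →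
        ContDiffOn ℝ ∞ φ (Ioo (-ε) ε) → (∀ n : ℕ, iteratedDeriv n φ 0 = 0) →
          ∀ᶠ t in 𝓝 (0 : ℝ), φ t = 0)
    (hstab : ∀ x : ℝ⸨X⸩, IsAlgebraic (RatFunc ℝ) x →
      IsAlgebraic (RatFunc ℝ) (LaurentSeries.derivative ℝ x))
    (hRP : ∀ (m : ℕ) (e : Fin m → ℝ) (u : Fin m → ℝ⸨X⸩) (v : ℝ⸨X⸩), LinearIndependent ℚ e →
      (∀ j, IsAlgebraic (RatFunc ℝ) (u j)) → (∀ j, u j ≠ 0) → IsAlgebraic (RatFunc ℝ) v →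
      (∑ j, HahnSeries.C (e j) * ((u j)⁻¹ * LaurentSeries.derivative ℝ (u j))) +
          LaurentSeries.derivative ℝ v = 0 →
        ∀ j, LaurentSeries.derivative ℝ (u j) = 0)
    (habs : ∀ (L : Type) [Field L] [CharZero L] (D : Derivation ℤ L L) (F : Subfield L),
      (∀ x ∈ F, D x ∈ F) → (∀ x, D x = 0 → x ∈ F) →
      (∀ (m : ℕ) (c u : Fin m → L) (v : L), (∀ j, D (c j) = 0) → LinearIndependent ℚ c →
        (∀ j, u j ∈ F) → (∀ j, u j ≠ 0) → v ∈ F →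
        (∑ j, c j * ((u j)⁻¹ * D (u j))) + D v = 0 → ∀ j, D (u j) = 0) →
      ∀ (k : ℕ) (η w y : Fin k → L) (g : L), (∀ i, η i ∈ F) → (∀ i, w i ∈ F) →
        (∀ i, w i ≠ 0) → (∀ i, D (y i) = (w i)⁻¹ * D (w i)) → g ∈ F →
        ∑ i, η i * y i = g →
        ∀ p : Fin k → ℤ,
          (∀ f : Fin k → ℤ, D (∑ i, (f i : L) * y i) = 0 → ∑ i, p i * f i = 0) →
          ∑ i, (p i : L) * η i = 0)
    (horth : ∀ (k : ℕ) (S : Set (Fin k → ℤ)) (v : Fin k → ℝ),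
      (∀ p : Fin k → ℤ, (∀ f ∈ S, ∑ i, p i * f i = 0) → ∑ i, (p i : ℝ) * v i = 0) →
      v ∈ Submodule.span ℝ {φ : Fin k → ℝ | ∃ f ∈ S, φ = fun i => (f i : ℝ)})
    {n k : ℕ} {C : Set (Fin n → ℝ)} (hCs : IsSemialgebraic ℚ C) (hCo : IsOpen C)
    (h W : Fin k → (Fin n → ℝ) → ℝ) (g : (Fin n → ℝ) → ℝ)
    (hhs : ∀ i, IsSemialgebraicFunOn ℚ C (h i)) (hWs : ∀ i, IsSemialgebraicFunOn ℚ C (W i))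
    (hgs : IsSemialgebraicFunOn ℚ C g)
    (hhc : ∀ i, ContDiffOn ℝ ∞ (h i) C) (hWc : ∀ i, ContDiffOn ℝ ∞ (W i) C)
    (hgc : ContDiffOn ℝ ∞ g C) (hWpos : ∀ i, ∀ x ∈ C, 0 < W i x)
    (hrel : ∀ x ∈ C, ∑ i, h i x * Real.log (W i x) = g x)
    (hdich : ∀ f : Fin k → ℤ, (∃ θ : ℝ, ∀ x ∈ C, ∏ i, W i x ^ (f i) = θ) ∨
      interior {x ∈ C | ∀ j : Fin n,
        ∑ i, (f i : ℝ) * (fderiv ℝ (W i) x (Pi.single j 1) / W i x) = 0} = ∅) :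
    ∀ x ∈ C, (fun i => h i x) ∈ Submodule.span ℝ
      {φ : Fin k → ℝ | ∃ f : Fin k → ℤ, (∃ θ : ℝ, ∀ y ∈ C, ∏ i, W i y ^ (f i) = θ) ∧
        φ = fun i => (f i : ℝ)} := by
  classical
  -- the lattice, the span, the log-gradient and the bad set
  set Λ : Set (Fin k → ℤ) := {f | ∃ θ : ℝ, ∀ y ∈ C, ∏ i, W i y ^ (f i) = θ} with hΛ
  have hset : {φ : Fin k → ℝ | ∃ f : Fin k → ℤ, (∃ θ : ℝ, ∀ y ∈ C, ∏ i, W i y ^ (f i) = θ) ∧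
      φ = fun i => (f i : ℝ)} = {φ : Fin k → ℝ | ∃ f ∈ Λ, φ = fun i => (f i : ℝ)} := by
    ext φ
    simp only [mem_setOf_eq, hΛ]
  rw [hset]
  set V : Submodule ℝ (Fin k → ℝ) :=
    Submodule.span ℝ {φ : Fin k → ℝ | ∃ f ∈ Λ, φ = fun i => (f i : ℝ)} with hV
  let Ω : Fin n → Fin k → (Fin n → ℝ) → ℝ := fun j i x => fderiv ℝ (W i) x (Pi.single j 1) / W i x
  let Z : (Fin k → ℤ) → Set (Fin n → ℝ) := fun f =>
    {x ∈ C | ∀ j : Fin n, ∑ i, (f i : ℝ) * Ω j i x = 0}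
  set B : Set (Fin n → ℝ) := ⋃ f ∈ Λᶜ, Z f with hB
  have hBnull : volume B = 0 := by
    refine (measure_biUnion_null_iff (Set.to_countable _)).2 fun f hf => ?_
    exact volume_eq_zero_of_interior_eq_empty (isSemialgebraic_logGradZero hCs hCo hWs hWc hWpos f)
      ((hdich f).resolve_left hf)
  -- the claim at good points
  have hgood : ∀ x₀ ∈ C \ B, (fun i => h i x₀) ∈ V := by
    intro x₀ hx₀
    obtain ⟨hx₀C, hx₀B⟩ := hx₀
    -- non-vanishing log-gradients off the lattice
    have hu : ∀ f : {f : Fin k → ℤ // f ∉ Λ}, (fun j => ∑ i, (f.1 i : ℝ) * Ω j i x₀) ≠ 0 := by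
      intro f hzero
      apply hx₀B
      rw [hB, mem_iUnion₂]
      exact ⟨f.1, f.2, hx₀C, fun j => congr_fun hzero j⟩
    obtain ⟨v, hv⟩ := exists_direction (fun (f : {f : Fin k → ℤ // f ∉ Λ}) j =>
      ∑ i, (f.1 i : ℝ) * Ω j i x₀) hu
    -- a segment inside the cell
    obtain ⟨r, hr, hball⟩ := Metric.isOpen_iff.1 hCo x₀ hx₀C
    set ε : ℝ := r / (‖v‖ + 1) with hε
    have hvpos : 0 < ‖v‖ + 1 := by positivity
    have hεpos : 0 < ε := div_pos hr hvpos
    have hseg : ∀ t ∈ Ioo (-ε) ε, x₀ + t • v ∈ C := by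
      intro t ht
      apply hball
      rw [Metric.mem_ball, dist_eq_norm, add_sub_cancel_left, norm_smul, Real.norm_eq_abs]
      have ht' : |t| < ε := abs_lt.2 ht
      calc |t| * ‖v‖ < ε * (‖v‖ + 1) := by
            have := norm_nonneg v
            nlinarith [abs_nonneg t]
        _ = r := div_mul_cancel₀ r hvpos.ne'
    -- one-variable data
    have hIset : IsSemialgebraic ℝ {x : Fin 1 → ℝ | x 0 ∈ Ioo (-ε) ε} :=
      isSemialgebraic_setOf_apply_mem_Ioo _ _
    have hηs : ∀ i, IsSemialgebraicFunOn ℝ {x : Fin 1 → ℝ | x 0 ∈ Ioo (-ε) ε}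
        (fun x => h i (x₀ + x 0 • v)) := fun i =>
      isSemialgebraicFunOn_comp_line (isSemialgebraicFunOn_real_of_rat (hhs i)) x₀ v hseg
    have hws : ∀ i, IsSemialgebraicFunOn ℝ {x : Fin 1 → ℝ | x 0 ∈ Ioo (-ε) ε}
        (fun x => W i (x₀ + x 0 • v)) := fun i =>
      isSemialgebraicFunOn_comp_line (isSemialgebraicFunOn_real_of_rat (hWs i)) x₀ v hseg
    have hγs : IsSemialgebraicFunOn ℝ {x : Fin 1 → ℝ | x 0 ∈ Ioo (-ε) ε}
        (fun x => g (x₀ + x 0 • v)) :=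
      isSemialgebraicFunOn_comp_line (isSemialgebraicFunOn_real_of_rat hgs) x₀ v hseg
    have hlds : ∀ i, IsSemialgebraicFunOn ℝ {x : Fin 1 → ℝ | x 0 ∈ Ioo (-ε) ε}
        (fun x => deriv (fun s : ℝ => W i (x₀ + s • v)) (x 0) / W i (x₀ + x 0 • v)) := fun i =>
      IsSemialgebraicFunOn.div (isSemialgebraicFunOn_deriv_comp_line hCs hCo (hWs i) (hWc i) x₀ v hseg)
        (hws i) fun x hx => (hWpos i _ (hseg _ hx)).ne'
    have hηc : ∀ i, ContDiffOn ℝ ∞ (fun s : ℝ => h i (x₀ + s • v)) (Ioo (-ε) ε) := fun i =>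
      contDiffOn_comp_line (hhc i) x₀ v hseg
    have hwc : ∀ i, ContDiffOn ℝ ∞ (fun s : ℝ => W i (x₀ + s • v)) (Ioo (-ε) ε) := fun i =>
      contDiffOn_comp_line (hWc i) x₀ v hseg
    have hγc : ContDiffOn ℝ ∞ (fun s : ℝ => g (x₀ + s • v)) (Ioo (-ε) ε) :=
      contDiffOn_comp_line hgc x₀ v hseg
    have hwpos : ∀ i, ∀ t ∈ Ioo (-ε) ε, 0 < W i (x₀ + t • v) := fun i t ht =>
      hWpos i _ (hseg t ht)
    have hrel' : ∀ t ∈ Ioo (-ε) ε,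
        ∑ i, h i (x₀ + t • v) * Real.log (W i (x₀ + t • v)) = g (x₀ + t • v) := fun t ht =>
      hrel _ (hseg t ht)
    -- the engine at the point, for every `p` orthogonal to the lattice
    refine horth k Λ (fun i => h i x₀) fun p hp => ?_
    have key := engine_point hT hpoly hflat hstab hRP habs (fun i s => h i (x₀ + s • v))
      (fun i s => W i (x₀ + s • v)) (fun s => g (x₀ + s • v)) hεpos hηs hws hγs hlds hηc hwc hγc
      hwpos hrel' p ?_
    · simpa using key
    intro f hf
    by_cases hfΛ : f ∈ Λ
    · exact hp f hfΛ
    · exfalso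
      have h0 : deriv (fun s : ℝ => ∑ i, (f i : ℝ) * Real.log (W i (x₀ + s • v))) (0 : ℝ) = 0 :=
        hf.self_of_nhds
      have hmem0 : (0 : ℝ) ∈ Ioo (-ε) ε := ⟨by linarith, hεpos⟩
      rw [deriv_sum_mul_log (fun i s => W i (x₀ + s • v)) hwc hwpos f hmem0] at h0
      have hderiv : ∀ i, deriv (fun s : ℝ => W i (x₀ + s • v)) 0 =
          ∑ j, v j * fderiv ℝ (W i) x₀ (Pi.single j 1) := fun i => by
        have := deriv_comp_line hCo (hWc i) x₀ v (t := 0) (by simpa using hx₀C)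
        simpa using this
      apply hv ⟨f, hfΛ⟩
      simp only
      rw [← h0]
      simp only [hderiv, zero_smul, add_zero, Ω]
      simp only [Finset.mul_sum, Finset.sum_div]
      rw [Finset.sum_comm]
      refine Finset.sum_congr rfl fun i _ => Finset.sum_congr rfl fun j _ => ?_
      ring
  -- density and continuity
  intro x hx
  have hxcl : x ∈ closure (C \ B) := mem_closure_diff_of_null hCo hBnull hx
  haveI : (𝓝[C \ B] x).NeBot := mem_closure_iff_nhdsWithin_neBot.1 hxcl
  have hVc : IsClosed (V : Set (Fin k → ℝ)) := V.closed_of_finiteDimensional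
  have hcont : ContinuousOn (fun y => fun i => h i y) C :=
    continuousOn_pi.2 fun i => (hhc i).continuousOn
  have hsub : C \ B ⊆ C := fun y hy => hy.1
  have htend : Tendsto (fun y => fun i => h i y) (𝓝[C \ B] x) (𝓝 (fun i => h i x)) :=
    (hcont x hx).mono_left (nhdsWithin_mono x hsub)
  exact hVc.mem_of_tendsto htend (eventually_mem_nhdsWithin.mono fun y hy => hgood y hy)

end CellMain

/-- **Registered ∀-form** of `exists_direction` (helper of `stub_structure`, line
`ax-schanuel-germs`): countably many non-zero vectors admit a common non-orthogonal direction.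
[folklore] -/
theorem structure_engineCell_direction : ∀ (n k : ℕ) (u : (Fin k → ℤ) → Fin n → ℝ)
    (S : Set (Fin k → ℤ)), (∀ f ∈ S, u f ≠ 0) → ∃ v : Fin n → ℝ, ∀ f ∈ S, ∑ j, v j * u f j ≠ 0 := by
  intro n k u S hu
  obtain ⟨v, hv⟩ := exists_direction (fun f : S => u f.1) fun f => hu f.1 f.2
  exact ⟨v, fun f hf => hv ⟨f, hf⟩⟩

end Summit.KontsevichZagierPeriods.LiouvilleUnfolding.LogPrimitiveNL.AxSchanuelGerms

end
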